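import Summits.AtomisticToContinuum.FouriersLaw.Theses.OddSectorIrreversibility

/-!
# `ResponseDensity` for chains with at most one site (`N ≤ 1`): the response density is `0`

Helper file for item stmt-AtomisticToContinuum-9144 (`ResponseDensity`, route
`OddSectorIrreversibility`, sub-problem `FouriersLaw` of `AtomisticToContinuum`).

For `N = 0` the phase space is a point and the generator vanishes; for `N = 1` both Langevin baths
act on the same momentum, so `OscillatorChain.generator 1 T_L T_R` depends on the bath temperatures
only through `T_L + T_R`. Hence for `N ≤ 1` the weak steady states at `(T + δ/2, T - δ/2)` are
exactly the weak steady states at `(T, T)`, and under uniqueness of the weak steady state every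
steady family satisfies `μ_{N,T+δ/2,T-δ/2} = μ_{N,T,T}` for `|δ| < 2T`: all difference quotients in
the bath-temperature difference vanish identically near `δ = 0`, and the conclusion of
`ResponseDensity` holds with response density `h = 0`.

Main result: `responseDensity_conclusion_of_le_one` (for an arbitrary `OscillatorChain`).
-/

noncomputable section

open MeasureTheory Filter Topology
open scoped ContDiff

namespace Summit.AtomisticToContinuum.FouriersLaw.Theorems

open Literature.MathematicalPhysics.KineticTheory.HeatConduction

/-- For `N ≤ 1` the generator of the chain between baths at `T_L, T_R` depends on the bath
temperatures only through their sum (for `N = 1` both baths act on the single momentum; for `N = 0`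
the generator is `0`). -/
theorem generator_eq_of_le_one (P : OscillatorChain) {N : ℕ} (hN : N ≤ 1)
    {T_L T_R T_L' T_R' : ℝ} (h : T_L + T_R = T_L' + T_R') :
    P.generator N T_L T_R = P.generator N T_L' T_R' := by
  funext f x
  rcases Nat.le_one_iff_eq_zero_or_eq_one.mp hN with rfl | rfl
  · simp [OscillatorChain.generator]
  · simp only [OscillatorChain.generator, Fin.sum_univ_one, Fin.val_zero, Nat.sub_self, if_true]
    linear_combination (P.γ * partialP 0 (partialP 0 f) x) * h

/-- For `N ≤ 1`, being a weak steady state at `(T_L, T_R)` only depends on `T_L + T_R`. -/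
theorem isSteadyState_iff_of_le_one (P : OscillatorChain) {N : ℕ} (hN : N ≤ 1)
    {T_L T_R T_L' T_R' : ℝ} (h : T_L + T_R = T_L' + T_R') (μ : Measure (PhaseSpace N)) :
    P.IsSteadyState N T_L T_R μ ↔ P.IsSteadyState N T_L' T_R' μ := by
  unfold OscillatorChain.IsSteadyState
  rw [generator_eq_of_le_one P hN h]

/-- Under uniqueness of the weak steady state at `(T, T)` (`N ≤ 1`, `T > 0`), every steady family
is constant along the anti-diagonal near `δ = 0`: `μ (T + δ/2) (T - δ/2) = μ T T` for `|δ| < 2T`,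
in particular eventually along `𝓝[≠] 0`. -/
theorem steadyFamily_eventuallyEq_of_le_one (P : OscillatorChain) {N : ℕ} (hN : N ≤ 1)
    {T : ℝ} (hT : 0 < T)
    (huniq : ∀ μ ν : Measure (PhaseSpace N), P.IsSteadyState N T T μ →
      P.IsSteadyState N T T ν → μ = ν)
    (μ : ℝ → ℝ → Measure (PhaseSpace N))
    (hμ : ∀ T_L T_R : ℝ, 0 < T_L → 0 < T_R → P.IsSteadyState N T_L T_R (μ T_L T_R)) :
    ∀ᶠ δ in 𝓝[≠] (0 : ℝ), μ (T + δ / 2) (T - δ / 2) = μ T T := by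
  have hball : ∀ᶠ δ in 𝓝 (0 : ℝ), |δ| < 2 * T := by
    have : Metric.ball (0 : ℝ) (2 * T) ∈ 𝓝 (0 : ℝ) := Metric.ball_mem_nhds 0 (by positivity)
    filter_upwards [this] with δ hδ
    simpa [Real.dist_eq] using hδ
  refine (hball.filter_mono nhdsWithin_le_nhds).mono fun δ hδ => ?_
  have h1 : 0 < T + δ / 2 := by
    have := neg_abs_le δ
    linarith
  have h2 : 0 < T - δ / 2 := by
    have := le_abs_self δ
    linarith
  have hst : P.IsSteadyState N T T (μ (T + δ / 2) (T - δ / 2)) :=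
    (isSteadyState_iff_of_le_one P hN (by ring) _).mp (hμ _ _ h1 h2)
  exact huniq _ _ hst (hμ T T hT hT)

/-- **`ResponseDensity` for `N ≤ 1`.** For a chain `P` with at most one site, if the weak steady
state at `(T, T)` is unique (`T > 0`), then for every steady family `μ` the conclusion of
`ResponseDensity` holds at `(T, N)` with response density `h = 0`: all difference quotients
`δ⁻¹(∫F dμ_{T+δ/2,T-δ/2} - ∫F dμ_{T,T})` vanish for `0 < |δ| < 2T`. -/
theorem responseDensity_conclusion_of_le_one (P : OscillatorChain) {N : ℕ} (hN : N ≤ 1)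
    {T : ℝ} (hT : 0 < T)
    (huniq : ∀ μ ν : Measure (PhaseSpace N), P.IsSteadyState N T T μ →
      P.IsSteadyState N T T ν → μ = ν)
    (μ : ℝ → ℝ → Measure (PhaseSpace N))
    (hμ : ∀ T_L T_R : ℝ, 0 < T_L → 0 < T_R → P.IsSteadyState N T_L T_R (μ T_L T_R)) :
    ∃ h : PhaseSpace N → ℝ,
      MemLp h 2 (μ T T) ∧
      (∀ F : PhaseSpace N → ℝ, ContDiff ℝ ((⊤ : ℕ∞) : WithTop ℕ∞) F → HasCompactSupport F →
        Tendsto (fun δ : ℝ => ((∫ x, F x ∂(μ (T + δ / 2) (T - δ / 2))) - ∫ x, F x ∂(μ T T)) / δ)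
          (𝓝[≠] 0) (𝓝 (∫ x, F x * h x ∂(μ T T)))) ∧
      (∀ i : Fin N, Tendsto (fun δ : ℝ =>
          ((∫ x, P.bondCurrent N i x ∂(μ (T + δ / 2) (T - δ / 2))) -
            ∫ x, P.bondCurrent N i x ∂(μ T T)) / δ)
          (𝓝[≠] 0) (𝓝 (∫ x, P.bondCurrent N i x * h x ∂(μ T T)))) := by
  have hev := steadyFamily_eventuallyEq_of_le_one P hN hT huniq μ hμ
  have key : ∀ G : PhaseSpace N → ℝ,
      Tendsto (fun δ : ℝ => ((∫ x, G x ∂(μ (T + δ / 2) (T - δ / 2))) - ∫ x, G x ∂(μ T T)) / δ)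
        (𝓝[≠] 0) (𝓝 (∫ x, G x * (0 : PhaseSpace N → ℝ) x ∂(μ T T))) := by
    intro G
    have h0 : (∫ x, G x * (0 : PhaseSpace N → ℝ) x ∂(μ T T)) = 0 := by simp
    rw [h0]
    refine (tendsto_const_nhds (x := (0 : ℝ))).congr' ?_
    filter_upwards [hev] with δ hδ
    rw [hδ, sub_self, zero_div]
  exact ⟨0, MemLp.zero, fun F _ _ => key F, fun i => key _⟩

end Summit.AtomisticToContinuum.FouriersLaw.Theorems

end
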